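import Literature.Geometry.Manifold.InverseFunctionTheorem
import HarnessLib

/-!
# Inverse function theorem for manifolds, chart-level form

Topic `Geometry/Manifold`; namespace `Literature.Geometry.Manifold`. A companion to
`InverseFunctionTheorem.lean` (`isLocalDiffeomorphAt_of_mfderiv`): instead of the invertibility
of `mfderiv` (which refers to the preferred charts `chartAt`), it suffices to know that the map read
in ANY pair of charts of the maximal atlases has an invertible derivative at the point
(`isLocalDiffeomorphAt_of_hasFDerivAt_charts`). The bridge is `mfderiv_eq_of_hasFDerivAt_charts`:
the differential in the preferred charts is conjugate to the one in the given charts by the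
(invertible) derivatives of the chart transitions (`exists_equiv_hasFDerivAt_transition`).
Manifolds are modelled on complete normed spaces with the trivial model `𝓘(ℝ, E)`.

## References

* J. M. Lee, *Introduction to Smooth Manifolds*, 2nd ed. (2013), Prop. 3.23–3.24 and Thm. 4.5
  (chart independence of the rank of the differential; inverse function theorem). [folklore]
-/

noncomputable section

open scoped Manifold ContDiff Topology
open Set Function Filter IsManifold

namespace Literature.Geometry.Manifold

variable {E : Type*} [NormedAddCommGroup E] [NormedSpace ℝ E]
  {E' : Type*} [NormedAddCommGroup E'] [NormedSpace ℝ E']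
  {M : Type*} [TopologicalSpace M] [ChartedSpace E M]
  {N : Type*} [TopologicalSpace N] [ChartedSpace E' N]
  {n : WithTop ℕ∞}

/-- **Derivatives of mutually inverse maps are mutually inverse**: if `τ' ∘ τ = id` near `p`
and `τ ∘ τ' = id` near `τ p`, the derivative of `τ` at `p` is a continuous linear equivalence.
[folklore] -/
theorem exists_equiv_of_hasFDerivAt_inverse {F : Type*} [NormedAddCommGroup F] [NormedSpace ℝ F]
    {F' : Type*} [NormedAddCommGroup F'] [NormedSpace ℝ F'] {τ : F → F'} {τ' : F' → F}
    {A : F →L[ℝ] F'} {A' : F' →L[ℝ] F} {p : F} (h : HasFDerivAt τ A p)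
    (h' : HasFDerivAt τ' A' (τ p)) (h1 : ∀ᶠ z in 𝓝 p, τ' (τ z) = z)
    (h2 : ∀ᶠ z in 𝓝 (τ p), τ (τ' z) = z) : ∃ T : F ≃L[ℝ] F', (T : F →L[ℝ] F') = A := by
  have c1 : HasFDerivAt (τ' ∘ τ) (A'.comp A) p := h'.comp p h
  have e1 : A'.comp A = ContinuousLinearMap.id ℝ F :=
    (c1.congr_of_eventuallyEq (h1.mono fun z hz => by simp [hz])).unique (hasFDerivAt_id p)
  have hp : τ' (τ p) = p := h1.self_of_nhds
  have c2 : HasFDerivAt (τ ∘ τ') (A.comp A') (τ p) := by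
    have h'' : HasFDerivAt τ A (τ' (τ p)) := by rw [hp]; exact h
    exact h''.comp _ h'
  have e2 : A.comp A' = ContinuousLinearMap.id ℝ F' :=
    (c2.congr_of_eventuallyEq (h2.mono fun z hz => by simp [hz])).unique (hasFDerivAt_id _)
  have l1 : LeftInverse A' A := fun v => by
    have := congrArg (fun B : F →L[ℝ] F => B v) e1
    simpa using this
  have l2 : RightInverse A' A := fun v => by
    have := congrArg (fun B : F' →L[ℝ] F' => B v) e2
    simpa using this
  exact ⟨ContinuousLinearEquiv.equivOfInverse A A' l1 l2, by ext v; rfl⟩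

section Transition

/-- **Transitions between charts of the maximal atlas are `C^n`.** [folklore] -/
theorem contDiffAt_transition {e e' : OpenPartialHomeomorph M E}
    (he : e ∈ maximalAtlas 𝓘(ℝ, E) n M) (he' : e' ∈ maximalAtlas 𝓘(ℝ, E) n M) {x : M}
    (hx : x ∈ e.source) (hx' : x ∈ e'.source) : ContDiffAt ℝ n (e' ∘ e.symm) (e x) := by
  have hc := ((contDiffGroupoid n 𝓘(ℝ, E)).compatible_of_mem_maximalAtlas he he').1
  simp only [contDiffPregroupoid, modelWithCornersSelf_coe, modelWithCornersSelf_coe_symm,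
    CompTriple.comp_eq, range_id, inter_univ, preimage_id_eq, id_eq] at hc
  have hmem : e x ∈ (e.symm ≫ₕ e').source := by
    rw [OpenPartialHomeomorph.trans_source]
    exact ⟨e.map_source hx, by rw [mem_preimage, e.left_inv hx]; exact hx'⟩
  have h := hc.contDiffAt ((e.symm ≫ₕ e').open_source.mem_nhds hmem)
  rwa [OpenPartialHomeomorph.coe_trans] at h

/-- **The derivative of a chart transition is invertible** (`n ≠ 0`). [folklore] -/
theorem exists_equiv_hasFDerivAt_transition (hn : n ≠ 0) {e e' : OpenPartialHomeomorph M E}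
    (he : e ∈ maximalAtlas 𝓘(ℝ, E) n M) (he' : e' ∈ maximalAtlas 𝓘(ℝ, E) n M) {x : M}
    (hx : x ∈ e.source) (hx' : x ∈ e'.source) :
    ∃ T : E ≃L[ℝ] E, HasFDerivAt (e' ∘ e.symm) (T : E →L[ℝ] E) (e x) := by
  have hd : HasFDerivAt (e' ∘ e.symm) (fderiv ℝ (e' ∘ e.symm) (e x)) (e x) :=
    ((contDiffAt_transition he he' hx hx').differentiableAt hn).hasFDerivAt
  have hpt : (e' ∘ e.symm) (e x) = e' x := by simp [e.left_inv hx]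
  have hd' : HasFDerivAt (e ∘ e'.symm) (fderiv ℝ (e ∘ e'.symm) (e' x)) ((e' ∘ e.symm) (e x)) := by
    rw [hpt]
    exact ((contDiffAt_transition he' he hx' hx).differentiableAt hn).hasFDerivAt
  have h1 : ∀ᶠ z in 𝓝 (e x), (e ∘ e'.symm) ((e' ∘ e.symm) z) = z := by
    have hz : ∀ᶠ z in 𝓝 (e x), e.symm z ∈ e'.source :=
      (e.continuousAt_symm (e.map_source hx)).preimage_mem_nhds
        (by rw [e.left_inv hx]; exact e'.open_source.mem_nhds hx')
    filter_upwards [e.open_target.mem_nhds (e.map_source hx), hz] with z hz hz'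
    simp only [comp_apply]
    rw [e'.left_inv hz', e.right_inv hz]
  have h2 : ∀ᶠ z in 𝓝 ((e' ∘ e.symm) (e x)), (e' ∘ e.symm) ((e ∘ e'.symm) z) = z := by
    rw [hpt]
    have hz : ∀ᶠ z in 𝓝 (e' x), e'.symm z ∈ e.source :=
      (e'.continuousAt_symm (e'.map_source hx')).preimage_mem_nhds
        (by rw [e'.left_inv hx']; exact e.open_source.mem_nhds hx)
    filter_upwards [e'.open_target.mem_nhds (e'.map_source hx'), hz] with z hz hz'
    simp only [comp_apply]
    rw [e.left_inv hz', e'.right_inv hz]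
  obtain ⟨T, hT⟩ := exists_equiv_of_hasFDerivAt_inverse hd hd' h1 h2
  exact ⟨T, hT ▸ hd⟩

end Transition

section Charts

variable [IsManifold 𝓘(ℝ, E) n M] [IsManifold 𝓘(ℝ, E') n N]

/-- **The differential in the preferred charts is conjugate to the derivative in any charts.**
If `f` is `C^n` at `x` (`n ≠ 0`) and its expression `e' ∘ f ∘ e⁻¹` in charts `e ∋ x`, `e' ∋ f x`
of the maximal atlases has derivative a continuous linear equivalence `L` at `e x`, then
`mfderiv f x` is a continuous linear equivalence. [folklore] -/
theorem mfderiv_eq_of_hasFDerivAt_charts (hn : n ≠ 0) {f : M → N} {x : M}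
    {e : OpenPartialHomeomorph M E} (he : e ∈ maximalAtlas 𝓘(ℝ, E) n M)
    {e' : OpenPartialHomeomorph N E'} (he' : e' ∈ maximalAtlas 𝓘(ℝ, E') n N)
    (hx : x ∈ e.source) (hfx : f x ∈ e'.source) (hf : ContMDiffAt 𝓘(ℝ, E) 𝓘(ℝ, E') n f x)
    {L : E ≃L[ℝ] E'} (hL : HasFDerivAt (e' ∘ f ∘ e.symm) (L : E →L[ℝ] E') (e x)) :
    ∃ f' : E ≃L[ℝ] E', mfderiv 𝓘(ℝ, E) 𝓘(ℝ, E') f x = (f' : E →L[ℝ] E') := by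
  have hmd : MDifferentiableAt 𝓘(ℝ, E) 𝓘(ℝ, E') f x := hf.mdifferentiableAt hn
  have hcont : ContinuousAt f x := hmd.continuousAt
  set φ := chartAt E x with hφ
  set ψ := chartAt E' (f x) with hψ
  -- the two transitions and their invertible derivatives
  obtain ⟨T, hT⟩ := exists_equiv_hasFDerivAt_transition hn (chart_mem_maximalAtlas x) he
    (mem_chart_source E x) hx
  obtain ⟨T', hT'⟩ := exists_equiv_hasFDerivAt_transition hn he' (chart_mem_maximalAtlas (f x))
    hfx (mem_chart_source E' (f x))
  -- the map read in the preferred charts factors through the map read in `e`, `e'`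
  have h1 : ∀ᶠ z in 𝓝 (φ x), φ.symm z ∈ e.source :=
    (φ.continuousAt_symm (mem_chart_target E x)).preimage_mem_nhds
      (by rw [φ.left_inv (mem_chart_source E x)]; exact e.open_source.mem_nhds hx)
  have h2 : ∀ᶠ z in 𝓝 (φ x), f (φ.symm z) ∈ e'.source := by
    have hc : ContinuousAt (f ∘ φ.symm) (φ x) := by
      refine ContinuousAt.comp ?_ (φ.continuousAt_symm (mem_chart_target E x))
      rw [φ.left_inv (mem_chart_source E x)]; exact hcont
    refine hc.preimage_mem_nhds ?_
    simp only [comp_apply]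
    rw [φ.left_inv (mem_chart_source E x)]
    exact e'.open_source.mem_nhds hfx
  have heq : writtenInExtChartAt 𝓘(ℝ, E) 𝓘(ℝ, E') x f =ᶠ[𝓝 (φ x)]
      (ψ ∘ e'.symm) ∘ (e' ∘ f ∘ e.symm) ∘ (e ∘ φ.symm) := by
    filter_upwards [h1, h2] with z hz1 hz2
    simp only [writtenInExtChartAt, extChartAt_coe, extChartAt_coe_symm, modelWithCornersSelf_coe,
      modelWithCornersSelf_coe_symm, comp_apply, id_eq, e.left_inv hz1, e'.left_inv hz2]
    rfl
  -- chain rule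
  have hpt : (e ∘ φ.symm) (φ x) = e x := by simp [φ.left_inv (mem_chart_source E x)]
  have hpt' : (e' ∘ f ∘ e.symm) ((e ∘ φ.symm) (φ x)) = e' (f x) := by
    rw [hpt]; simp [e.left_inv hx]
  have hL' : HasFDerivAt (e' ∘ f ∘ e.symm) (L : E →L[ℝ] E') ((e ∘ φ.symm) (φ x)) := by
    rw [hpt]; exact hL
  have h12 : HasFDerivAt ((e' ∘ f ∘ e.symm) ∘ (e ∘ φ.symm))
      ((L : E →L[ℝ] E').comp (T : E →L[ℝ] E)) (φ x) := hL'.comp (φ x) hT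
  have hT'' : HasFDerivAt (ψ ∘ e'.symm) (T' : E' →L[ℝ] E')
      (((e' ∘ f ∘ e.symm) ∘ (e ∘ φ.symm)) (φ x)) := by
    rw [comp_apply, hpt']; exact hT'
  have hcomp : HasFDerivAt ((ψ ∘ e'.symm) ∘ (e' ∘ f ∘ e.symm) ∘ (e ∘ φ.symm))
      ((T' : E' →L[ℝ] E').comp ((L : E →L[ℝ] E').comp (T : E →L[ℝ] E))) (φ x) :=
    hT''.comp (φ x) h12
  have hw : HasFDerivAt (writtenInExtChartAt 𝓘(ℝ, E) 𝓘(ℝ, E') x f)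
      ((T' : E' →L[ℝ] E').comp ((L : E →L[ℝ] E').comp (T : E →L[ℝ] E))) (φ x) :=
    hcomp.congr_of_eventuallyEq heq
  refine ⟨(T.trans L).trans T', ?_⟩
  have hm := hmd.mfderiv
  rw [ModelWithCorners.Boundaryless.range_eq_univ, fderivWithin_univ] at hm
  rw [hm]
  have hφx : (extChartAt 𝓘(ℝ, E) x) x = φ x := by simp [hφ]
  rw [hφx, hw.fderiv]
  ext v
  simp

/-- **Inverse function theorem, chart-level form.** Let `f : M → N` be `C^n` (`n ≠ 0`) on an
open set `s ∋ x`, and suppose that in some charts `e ∋ x`, `e' ∋ f x` of the maximal atlases the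
expression `e' ∘ f ∘ e⁻¹` has derivative a continuous linear equivalence at `e x`. Then `f` is a
`C^n` local diffeomorphism at `x`. [folklore] -/
theorem isLocalDiffeomorphAt_of_hasFDerivAt_charts [CompleteSpace E] [CompleteSpace E']
    (hn : n ≠ 0) {f : M → N} {x : M} {s : Set M} (hs : IsOpen s) (hxs : x ∈ s)
    (hf : ContMDiffOn 𝓘(ℝ, E) 𝓘(ℝ, E') n f s)
    {e : OpenPartialHomeomorph M E} (he : e ∈ maximalAtlas 𝓘(ℝ, E) n M)
    {e' : OpenPartialHomeomorph N E'} (he' : e' ∈ maximalAtlas 𝓘(ℝ, E') n N)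
    (hx : x ∈ e.source) (hfx : f x ∈ e'.source)
    {L : E ≃L[ℝ] E'} (hL : HasFDerivAt (e' ∘ f ∘ e.symm) (L : E →L[ℝ] E') (e x)) :
    IsLocalDiffeomorphAt 𝓘(ℝ, E) 𝓘(ℝ, E') n f x := by
  obtain ⟨f', hf'⟩ := mfderiv_eq_of_hasFDerivAt_charts hn he he' hx hfx
    (hf.contMDiffAt (hs.mem_nhds hxs)) hL
  exact isLocalDiffeomorphAt_of_mfderiv hn hs hxs hf f' hf'

end Charts

end Literature.Geometry.Manifold

end
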